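import Literature.Probability.Percolation.TriInnerApproxLimit
import Literature.Probability.Percolation.TriLatticeDistances
import Literature.Probability.Percolation.TriTailPolyline
import Literature.Probability.Percolation.TriDiscInterface
import Mathlib.Topology.Subpath
import HarnessLib

/-!
# Tethers of the boundary darts of the inner approximation

Topic `Literature/Probability/Percolation`; family `crit-perc`. For the proof of Bollobás–Riordan,
*Percolation* (2006), Ch. 7 Lemma 14 (pp. 190–191): every boundary dart `(u, w)` of the inner
approximation `G = innerApprox D hδ hc₀` of a Jordan domain `D` at mesh `δ` carries a **tether**, a
path in the plane from the mesh point of `u` through the midpoint of the mesh edge `[u, w]` to a point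
of `∂D`, within `12δ` of its start, inside `D` except for its endpoint, and which after the midpoint meets
neither a closed mesh edge between two sites of `G` nor a segment joining the centres of two adjacent
faces of `G` (B–R p. 191: "every `z ∈ ∂⁺G_δ⁻` is within distance `ε₄ + 2δ` of a point `Γ`" — the
tether realises such a point by a path avoiding the discrete structure, which is what the winding
argument replacing B–R's corner analysis needs).

Main results:
* plane geometry at unit scale and at mesh `δ`: `cellForm_hexCenter`, `hexCenter_mem_triCell`,
  `segment_hexCenter_subset` (the centre segment of two adjacent faces lies in their two cells),
  `dist_faceVertex_le_one_of_mem_triCell` (a cell lies within `1` of each of its vertices), and the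
  avoidance lemmas `not_mem_meshEdge_of_mem_meshEdgeSet`, `not_mem_centreSeg_of_mem_meshEdgeSet`,
  `le_dist_of_mem_meshEdge`, `le_dist_of_mem_centreSeg`;
* `exists_path_of_reflTransGen` — a lattice path inside a set of sites gives a plane path on the
  closed mesh edges between its sites (`meshEdgeSet`);
* `exists_stop` — the first exit parameter of a path leaving an open set (a frontier point, the
  path being inside before it); the tether is the initial segment `Path.subpath γ 0 s` (Mathlib);
* `Tether` (structure) and `exists_tether` — existence of a tether at every boundary dart of
  `innerApprox D hδ hc₀`.

## References

* B. Bollobás, O. Riordan, *Percolation*, Cambridge University Press (2006), Ch. 7 §7.2.5 pp. 190–191.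

## Mathlib / tree

Mathlib: `Path`, `Path.trans`, `Path.segment`, `IsClosed.csInf_mem`, `mem_closure_of_tendsto`,
`Convex.segment_subset`, `Path.subpath`, `Path.cast`. Tree: `TriInnerApprox(Limit).lean` (`innerApprox`, `tileCentre_of_bdryDart`,
`exists_not_mem_of_not_mem_innerCoarse`, `closedBall_subset_of_mem_innerApprox`), `TriTileDomain.lean`
(`pathIn_tileUnion`), `TriLatticeRounding.lean` (`exists_dist_triMeshPoint_le`), `TriLatticeSegments.lean`
(`unitEdge_inter`, `eq_or_eq_of_triEmbed_mem_unitEdge`), `TriLatticeDistances.lean`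
(`sqrt_three_div_two_le_dist_of_mem_triCell`, `…_of_mem_unitEdge`), `TriTailPolyline.lean` (`meshCenter`,
`eq_side_of_mem_segment_mesh`), `TriLatticeCells.lean` (`triCell`, `cellForm_lineComb`, `convex_triCell`).
-/

noncomputable section

open Set Metric Complex Filter Topology Literature.Topology.PlaneTopology Literature.Probability.LatticeModels
  Literature.Probability.RandomPlanarGeometry

namespace Literature.Probability.Percolation

/-! ### Unit-scale geometry of centres and cells -/

/-- The barycentric coordinates of the centre of a face are `1/3`. [folklore] -/
theorem cellForm_hexCenter (F : HexVertex) (j : Fin 3) : cellForm F j (hexCenter F) = 1 / 3 := by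
  rcases F with ⟨x, t⟩
  rcases HexVertex.snd_eq_zero_or_one (x, t) with ht | ht <;> simp only at ht <;> subst ht <;>
    obtain rfl | rfl | rfl : j = 0 ∨ j = 1 ∨ j = 2 := (by fin_cases j <;> simp) <;>
    simp only [cellForm, triX_hexCenter, triY_hexCenter, Fin.isValue, ↓reduceIte, one_ne_zero, Matrix.cons_val_zero,
      Matrix.cons_val_one, Matrix.cons_val_two, Matrix.head_cons, Matrix.tail_cons, Fin.val_zero, Fin.val_one,
      Nat.cast_zero, Nat.cast_one] <;>
    ring

/-- The centre of a face lies in its cell. [folklore] -/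
theorem hexCenter_mem_triCell (F : HexVertex) : hexCenter F ∈ triCell F := fun j => by
  rw [cellForm_hexCenter]; norm_num

/-- The midpoint of the centres of `F` and `oppFace F j` lies in the cell of `F`. [folklore] -/
theorem midpoint_hexCenter_mem_triCell (F : HexVertex) (j : Fin 3) :
    midpoint ℝ (hexCenter F) (hexCenter (oppFace F j)) ∈ triCell F := by
  rw [midpoint_hexCenter_oppFace]
  exact (convex_triCell F).segment_subset (triEmbed_faceVertex_mem_triCell F _) (triEmbed_faceVertex_mem_triCell F _)
    (midpoint_mem_segment _ _)

/-- … and in the cell of `oppFace F j`. [folklore] -/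
theorem midpoint_hexCenter_mem_triCell' (F : HexVertex) (j : Fin 3) :
    midpoint ℝ (hexCenter F) (hexCenter (oppFace F j)) ∈ triCell (oppFace F j) := by
  have h := midpoint_hexCenter_mem_triCell (oppFace F j) (oppIdx F j)
  rwa [oppFace_oppFace, midpoint_comm] at h

/-- **The centre segment of two adjacent faces lies in their two cells.** [folklore] -/
theorem segment_hexCenter_subset (F : HexVertex) (j : Fin 3) :
    segment ℝ (hexCenter F) (hexCenter (oppFace F j)) ⊆ triCell F ∪ triCell (oppFace F j) := by
  rintro z ⟨a, b, ha, hb, hab, rfl⟩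
  set P := hexCenter F
  set Q := hexCenter (oppFace F j)
  have hM : midpoint ℝ P Q = (2⁻¹ : ℝ) • P + (2⁻¹ : ℝ) • Q := by
    rw [midpoint_eq_smul_add, smul_add]; norm_num
  by_cases hb2 : b ≤ 2⁻¹
  · left
    have e : a • P + b • Q = (a - b) • P + (2 * b) • midpoint ℝ P Q := by
      rw [hM, smul_add, smul_smul, smul_smul, ← add_assoc, ← add_smul]
      congr 2 <;> ring
    rw [e]
    exact (convex_triCell F) (hexCenter_mem_triCell F) (midpoint_hexCenter_mem_triCell F j) (by linarith) (by linarith)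
      (by linarith)
  · right
    rw [not_le] at hb2
    have e : a • P + b • Q = (2 * a) • midpoint ℝ P Q + (b - a) • Q := by
      rw [hM, smul_add, smul_smul, smul_smul, add_assoc, ← add_smul]
      congr 2 <;> [ring_nf; (congr 1; linarith)]
    rw [e]
    exact (convex_triCell _) (midpoint_hexCenter_mem_triCell' F j) (hexCenter_mem_triCell _) (by linarith) (by linarith)
      (by linarith)

/-- **A cell lies within `1` of each of its vertices.** [folklore] -/
theorem dist_faceVertex_le_one_of_mem_triCell {F : HexVertex} {z : ℂ} (hz : z ∈ triCell F) (k : Fin 3) :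
    dist z (triEmbed (faceVertex F k)) ≤ 1 := by
  have hsum := sum_cellForm F z
  have hbar := baryc_eq F z
  set p := triEmbed (faceVertex F k)
  have key : z - p = (cellForm F 0 z : ℂ) * (triEmbed (faceVertex F 0) - p) +
      (cellForm F 1 z : ℂ) * (triEmbed (faceVertex F 1) - p) + (cellForm F 2 z : ℂ) * (triEmbed (faceVertex F 2) - p) := by
    have : (p : ℂ) = ((cellForm F 0 z + cellForm F 1 z + cellForm F 2 z : ℝ) : ℂ) * p := by
      rw [hsum]; push_cast; ring
    conv_lhs => rw [hbar, this]
    push_cast; ring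
  have hvv : ∀ k', ‖triEmbed (faceVertex F k') - p‖ ≤ 1 := by
    intro k'
    by_cases hk : k' = k
    · subst hk; simp [p]
    · have hadj : triGraph.Adj (faceVertex F k') (faceVertex F k) := by
        have h3 : ∀ a b : Fin 3, a ≠ b → b = a + 1 ∨ a = b + 1 := by decide
        have e1 : ∀ a : Fin 3, a + 2 + 1 = a := by decide
        have e2 : ∀ a : Fin 3, a + 2 + 2 = a + 1 := by decide
        rcases h3 k' k hk with h | h
        · have := triGraph_adj_faceVertex_succ F (k' + 2)
          rwa [e1, e2, ← h] at this
        · have := triGraph_adj_faceVertex_succ F (k + 2)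
          rw [e1, e2, ← h] at this
          exact this.symm
      exact (norm_triEmbed_eq_one_of_adj hadj).le
  rw [dist_eq_norm, key]
  have hn : ∀ k', ‖(cellForm F k' z : ℂ) * (triEmbed (faceVertex F k') - p)‖ ≤ cellForm F k' z := fun k' ↦ by
    rw [norm_mul, Complex.norm_real, Real.norm_eq_abs, abs_of_nonneg (hz k')]
    simpa using mul_le_mul_of_nonneg_left (hvv k') (hz k')
  calc _ ≤ ‖(cellForm F 0 z : ℂ) * (triEmbed (faceVertex F 0) - p) + (cellForm F 1 z : ℂ) * (triEmbed (faceVertex F 1) - p)‖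
        + ‖(cellForm F 2 z : ℂ) * (triEmbed (faceVertex F 2) - p)‖ := norm_add_le _ _
    _ ≤ (‖(cellForm F 0 z : ℂ) * (triEmbed (faceVertex F 0) - p)‖ + ‖(cellForm F 1 z : ℂ) * (triEmbed (faceVertex F 1) - p)‖)
        + ‖(cellForm F 2 z : ℂ) * (triEmbed (faceVertex F 2) - p)‖ := by gcongr; exact norm_add_le _ _
    _ ≤ (cellForm F 0 z + cellForm F 1 z) + cellForm F 2 z := by gcongr <;> exact hn _
    _ = 1 := by linarith

/-- A cell lies within `1` of each of its vertices (membership form). [folklore] -/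
theorem dist_le_one_of_mem_triCell_of_mem {F : HexVertex} {z : ℂ} (hz : z ∈ triCell F) {v : Site 2}
    (hv : v ∈ hexFaceVertices F) : dist z (triEmbed v) ≤ 1 := by
  obtain ⟨k, rfl⟩ := mem_hexFaceVertices_iff_faceVertex.1 hv
  exact dist_faceVertex_le_one_of_mem_triCell hz k

/-! ### Mesh-scale versions -/

/-- Scaling a distance by the mesh. [folklore] -/
theorem dist_ofReal_mul (δ : ℝ) (z w : ℂ) : dist ((δ : ℂ) * z) ((δ : ℂ) * w) = |δ| * dist z w := by
  rw [dist_eq_norm, dist_eq_norm, ← mul_sub, norm_mul, Complex.norm_real, Real.norm_eq_abs]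

/-- Undoing the mesh scaling. [folklore] -/
theorem ofReal_mul_inv_mul {δ : ℝ} (hδ : δ ≠ 0) (z : ℂ) : (δ : ℂ) * ((δ⁻¹ : ℂ) * z) = z := by
  rw [← mul_assoc, mul_inv_cancel₀ (Complex.ofReal_ne_zero.2 hδ), one_mul]

/-- **The centre segment of two adjacent faces at mesh `δ` lies within `δ` of each common… of each
vertex of either face**: precisely, within `δ` of the mesh point of any vertex of `F`. [folklore] -/
theorem dist_le_of_mem_centreSeg {δ : ℝ} (hδ : 0 < δ) {F : HexVertex} {j : Fin 3} {z : ℂ}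
    (hz : z ∈ segment ℝ (meshCenter δ F) (meshCenter δ (oppFace F j))) {v : Site 2}
    (hv : v ∈ hexFaceVertices F) (hv' : v ∈ hexFaceVertices (oppFace F j)) : dist z (triMeshPoint δ v) ≤ δ := by
  rw [meshCenter, meshCenter, mem_segment_ofReal_mul_iff hδ.ne'] at hz
  have hz' : dist ((δ⁻¹ : ℂ) * z) (triEmbed v) ≤ 1 := by
    rcases segment_hexCenter_subset F j hz with h | h
    · exact dist_le_one_of_mem_triCell_of_mem h hv
    · exact dist_le_one_of_mem_triCell_of_mem h hv'
  have e : z = (δ : ℂ) * ((δ⁻¹ : ℂ) * z) := (ofReal_mul_inv_mul hδ.ne' z).symm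
  rw [e, triMeshPoint, dist_ofReal_mul, abs_of_pos hδ]
  exact (mul_le_mul_of_nonneg_left hz' hδ.le).trans_eq (mul_one δ)

/-- **A cell at mesh `δ` lies within `δ` of the mesh point of each of its vertices.** [folklore] -/
theorem dist_le_of_mem_triCell_mesh {δ : ℝ} (hδ : 0 < δ) {F : HexVertex} {z : ℂ} (hz : (δ⁻¹ : ℂ) * z ∈ triCell F)
    {v : Site 2} (hv : v ∈ hexFaceVertices F) : dist z (triMeshPoint δ v) ≤ δ := by
  have hz' := dist_le_one_of_mem_triCell_of_mem hz hv
  have e : z = (δ : ℂ) * ((δ⁻¹ : ℂ) * z) := (ofReal_mul_inv_mul hδ.ne' z).symm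
  rw [e, triMeshPoint, dist_ofReal_mul, abs_of_pos hδ]
  exact (mul_le_mul_of_nonneg_left hz' hδ.le).trans_eq (mul_one δ)

/-- **Points of the centre segment of two faces not having `a` as a vertex are at distance at least
`(√3/2) δ` from the mesh point of `a`.** [folklore] -/
theorem le_dist_of_mem_centreSeg {δ : ℝ} (hδ : 0 < δ) {F : HexVertex} {j : Fin 3} {z : ℂ}
    (hz : z ∈ segment ℝ (meshCenter δ F) (meshCenter δ (oppFace F j))) {a : Site 2}
    (ha : a ∉ hexFaceVertices F) (ha' : a ∉ hexFaceVertices (oppFace F j)) :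
    Real.sqrt 3 / 2 * δ ≤ dist z (triMeshPoint δ a) := by
  rw [meshCenter, meshCenter, mem_segment_ofReal_mul_iff hδ.ne'] at hz
  have hz' : Real.sqrt 3 / 2 ≤ dist ((δ⁻¹ : ℂ) * z) (triEmbed a) := by
    rcases segment_hexCenter_subset F j hz with h | h
    · exact sqrt_three_div_two_le_dist_of_mem_triCell h ha
    · exact sqrt_three_div_two_le_dist_of_mem_triCell h ha'
  have e : z = (δ : ℂ) * ((δ⁻¹ : ℂ) * z) := (ofReal_mul_inv_mul hδ.ne' z).symm
  rw [e, triMeshPoint, dist_ofReal_mul, abs_of_pos hδ, mul_comm]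
  exact mul_le_mul_of_nonneg_left hz' hδ.le

/-- **Points of a closed mesh edge not ending at `a` are at distance at least `(√3/2) δ` from the
mesh point of `a`.** [folklore] -/
theorem le_dist_of_mem_meshEdge {δ : ℝ} (hδ : 0 < δ) {b : Site 2} {k : Fin 6} {q : ℂ}
    (hq : q ∈ segment ℝ (triMeshPoint δ b) (triMeshPoint δ (b + triDir k))) {a : Site 2} (ha : a ≠ b)
    (ha' : a ≠ b + triDir k) : Real.sqrt 3 / 2 * δ ≤ dist q (triMeshPoint δ a) := by
  rw [triMeshPoint, triMeshPoint, mem_segment_ofReal_mul_iff hδ.ne'] at hq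
  have hq' := sqrt_three_div_two_le_dist_of_mem_unitEdge hq ha ha'
  have e : q = (δ : ℂ) * ((δ⁻¹ : ℂ) * q) := (ofReal_mul_inv_mul hδ.ne' q).symm
  rw [e, triMeshPoint, dist_ofReal_mul, abs_of_pos hδ, mul_comm]
  exact mul_le_mul_of_nonneg_left hq' hδ.le

/-- **Two closed mesh edges meet only at a common endpoint, unless they coincide** (mesh-`δ` form of
`unitEdge_inter`). [folklore] -/
theorem meshEdge_inter {δ : ℝ} (hδ : δ ≠ 0) {a c : Site 2} {k l : Fin 6} {q : ℂ}
    (hq1 : q ∈ segment ℝ (triMeshPoint δ a) (triMeshPoint δ (a + triDir k)))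
    (hq2 : q ∈ segment ℝ (triMeshPoint δ c) (triMeshPoint δ (c + triDir l))) :
    ((q = triMeshPoint δ a ∨ q = triMeshPoint δ (a + triDir k)) ∧ (q = triMeshPoint δ c ∨ q = triMeshPoint δ (c + triDir l))) ∨
      (a = c ∧ a + triDir k = c + triDir l) ∨ (a = c + triDir l ∧ a + triDir k = c) := by
  rw [triMeshPoint, triMeshPoint, mem_segment_ofReal_mul_iff hδ] at hq1 hq2
  have e : ∀ x : Site 2, q = triMeshPoint δ x ↔ (δ⁻¹ : ℂ) * q = triEmbed x := fun x => by
    rw [triMeshPoint]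
    constructor
    · rintro rfl; rw [← mul_assoc, inv_mul_cancel₀ (Complex.ofReal_ne_zero.2 hδ), one_mul]
    · intro h; rw [← h, ofReal_mul_inv_mul hδ]
  simp only [e]
  exact unitEdge_inter hq1 hq2

/-- **A mesh point on a closed mesh edge is one of its endpoints.** [folklore] -/
theorem eq_or_eq_of_triMeshPoint_mem_meshEdge {δ : ℝ} (hδ : δ ≠ 0) {a v : Site 2} {k : Fin 6}
    (hv : triMeshPoint δ v ∈ segment ℝ (triMeshPoint δ a) (triMeshPoint δ (a + triDir k))) : v = a ∨ v = a + triDir k := by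
  rw [triMeshPoint, triMeshPoint, triMeshPoint, mem_segment_ofReal_mul_iff hδ, ← mul_assoc,
    inv_mul_cancel₀ (Complex.ofReal_ne_zero.2 hδ), one_mul] at hv
  exact eq_or_eq_of_triEmbed_mem_unitEdge hv

/-! ### Plane paths along lattice paths -/

/-- The closed mesh edges (and mesh points) at mesh `δ` with both endpoints in `A`. [folklore] -/
def meshEdgeSet (δ : ℝ) (A : Set (Site 2)) : Set ℂ :=
  {z | ∃ x y : Site 2, x ∈ A ∧ y ∈ A ∧ (x = y ∨ triGraph.Adj x y) ∧ z ∈ segment ℝ (triMeshPoint δ x) (triMeshPoint δ y)}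

/-- Mesh points of `A` belong to `meshEdgeSet δ A`. [folklore] -/
theorem triMeshPoint_mem_meshEdgeSet {δ : ℝ} {A : Set (Site 2)} {x : Site 2} (hx : x ∈ A) :
    triMeshPoint δ x ∈ meshEdgeSet δ A :=
  ⟨x, x, hx, hx, Or.inl rfl, left_mem_segment _ _ _⟩

/-- **A lattice path inside `A` gives a plane path along closed mesh edges between sites of `A`.**
[folklore] -/
theorem exists_path_of_reflTransGen (δ : ℝ) {A : Set (Site 2)} {x y : Site 2} (hx : x ∈ A)
    (h : Relation.ReflTransGen (fun a b => triGraph.Adj a b ∧ b ∈ A) x y) :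
    y ∈ A ∧ ∃ P : Path (triMeshPoint δ x) (triMeshPoint δ y), range P ⊆ meshEdgeSet δ A := by
  induction h with
  | refl =>
    exact ⟨hx, Path.refl _, by rw [Path.refl_range, singleton_subset_iff]; exact triMeshPoint_mem_meshEdgeSet hx⟩
  | tail _ hbc ih =>
    obtain ⟨hb, P, hP⟩ := ih
    refine ⟨hbc.2, P.trans (Path.segment _ _), ?_⟩
    rw [Path.trans_range, Path.range_segment, union_subset_iff]
    exact ⟨hP, fun z hz => ⟨_, _, hb, hbc.2, Or.inr hbc.1, hz⟩⟩

/-! ### Stopping a path at its first exit from an open set -/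

/-- **The first exit of a path from an open set**: a path from a point of an open set `U` to a point
off `U` has a first parameter at which it is off `U`; there it is on the frontier of `U`, and before
it is in `U`. [folklore] -/
theorem exists_stop {U : Set ℂ} (hU : IsOpen U) {p q : ℂ} (γ : Path p q) (hp : p ∈ U) (hq : q ∉ U) :
    ∃ s : unitInterval, 0 < (s : ℝ) ∧ γ s ∉ U ∧ γ s ∈ frontier U ∧ ∀ t : unitInterval, (t : ℝ) < s → γ t ∈ U := by
  set T : Set ℝ := Icc (0 : ℝ) 1 ∩ γ.extend ⁻¹' Uᶜ with hT
  have hTc : IsClosed T := isClosed_Icc.inter (hU.isClosed_compl.preimage γ.continuous_extend)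
  have h1T : (1 : ℝ) ∈ T := ⟨⟨zero_le_one, le_rfl⟩, by rw [mem_preimage, Path.extend_one]; exact hq⟩
  have hTbdd : BddBelow T := ⟨0, fun t ht => ht.1.1⟩
  set s := sInf T with hs
  have hsT : s ∈ T := hTc.csInf_mem ⟨1, h1T⟩ hTbdd
  have hs1 : s ≤ 1 := csInf_le hTbdd h1T
  have hs0 : 0 ≤ s := hsT.1.1
  have hlt : ∀ t, 0 ≤ t → t < s → γ.extend t ∈ U := fun t ht0 hts => by
    by_contra h
    exact absurd (csInf_le hTbdd ⟨⟨ht0, hts.le.trans hs1⟩, h⟩) (not_le.2 hts)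
  have hspos : 0 < s := by
    rcases hs0.eq_or_lt with h | h
    · exact absurd (show γ.extend s ∈ U by rw [← h, Path.extend_zero]; exact hp) hsT.2
    · exact h
  have hγs : γ.extend s = γ ⟨s, hs0, hs1⟩ := Path.extend_extends' γ ⟨s, hs0, hs1⟩
  refine ⟨⟨s, hs0, hs1⟩, hspos, ?_, ?_, fun t ht => ?_⟩
  · rw [← hγs]; exact hsT.2
  · rw [hU.frontier_eq, ← hγs]
    refine ⟨mem_closure_of_tendsto (γ.continuous_extend.continuousAt.continuousWithinAt (s := Iio s)) ?_, hsT.2⟩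
    filter_upwards [Ioo_mem_nhdsLT hspos] with t ht
    exact hlt t ht.1.le ht.2
  · have := hlt t t.2.1 ht
    rwa [Path.extend_extends'] at this

/-! ### Avoiding the discrete structure -/

/-- A point **avoids the discrete structure of `G` at mesh `δ`**: it lies on no closed mesh edge
between two sites of `G` and on no centre segment of two adjacent faces of `G` (a predicate relative
to the site set `G`; not to be confused with the region-based `LatticeModels.Mesh.AvoidsMesh` /
`LatticeModels.TriMesh.AvoidsMesh`, which have no centre-segment clause). [folklore] -/
def AvoidsMeshOf (G : Finset (Site 2)) (δ : ℝ) (z : ℂ) : Prop :=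
  (∀ g ∈ G, ∀ g' ∈ G, triGraph.Adj g g' → z ∉ segment ℝ (triMeshPoint δ g) (triMeshPoint δ g')) ∧
    ∀ (F : HexVertex) (j : Fin 3), hexFaceVertices F ⊆ G → hexFaceVertices (oppFace F j) ⊆ G →
      z ∉ segment ℝ (meshCenter δ F) (meshCenter δ (oppFace F j))

/-- Injectivity of the mesh points. [folklore] -/
theorem eq_of_triMeshPoint_eq {δ : ℝ} (hδ : δ ≠ 0) {x y : Site 2} (h : triMeshPoint δ x = triMeshPoint δ y) : x = y :=
  triEmbed_injective (mul_left_cancel₀ (Complex.ofReal_ne_zero.2 hδ) (show (δ : ℂ) * triEmbed x = δ * triEmbed y from h))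

/-- **Points of closed mesh edges between sites off `G` avoid the discrete structure of `G`.**
[folklore] -/
theorem avoidsMeshOf_of_mem_meshEdgeSet {G : Finset (Site 2)} {δ : ℝ} (hδ : δ ≠ 0) {A : Set (Site 2)}
    (hA : ∀ x ∈ A, x ∉ G) {z : ℂ} (hz : z ∈ meshEdgeSet δ A) : AvoidsMeshOf G δ z := by
  obtain ⟨x, y, hx, hy, hxy, hz⟩ := hz
  constructor
  · intro g hg g' hg' hgg' hz'
    obtain ⟨l, rfl⟩ := (triGraph_adj_iff_triDir g g').1 hgg'
    rcases hxy with rfl | hxy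
    · rw [segment_same, mem_singleton_iff] at hz
      subst hz
      rcases eq_or_eq_of_triMeshPoint_mem_meshEdge hδ hz' with rfl | rfl
      · exact hA _ hx hg
      · exact hA _ hx hg'
    · obtain ⟨k, rfl⟩ := (triGraph_adj_iff_triDir x y).1 hxy
      rcases meshEdge_inter hδ hz hz' with ⟨h1, h2⟩ | ⟨rfl, -⟩ | ⟨rfl, -⟩
      · rcases h1 with rfl | rfl <;> rcases h2 with h2 | h2 <;>
          first
          | exact hA _ hx (eq_of_triMeshPoint_eq hδ h2 ▸ hg)
          | exact hA _ hx (eq_of_triMeshPoint_eq hδ h2 ▸ hg')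
          | exact hA _ hy (eq_of_triMeshPoint_eq hδ h2 ▸ hg)
          | exact hA _ hy (eq_of_triMeshPoint_eq hδ h2 ▸ hg')
      · exact hA _ hx hg
      · exact hA _ hx hg'
  · intro F j hF hF' hz'
    rcases eq_side_of_mem_segment_mesh hδ hxy hz hz' with ⟨h1, -⟩ | ⟨h1, -⟩
    · exact hA _ hx (hF (h1 ▸ faceVertex_mem F _))
    · exact hA _ hx (hF (h1 ▸ faceVertex_mem F _))

/-- **Points of the mesh edge `[u, w]` other than the mesh point of `u`, with `w ∉ G`, avoid the
discrete structure of `G`.** [folklore] -/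
theorem avoidsMeshOf_of_mem_segment {G : Finset (Site 2)} {δ : ℝ} (hδ : δ ≠ 0) {u w : Site 2} (hw : w ∉ G)
    (huw : triGraph.Adj u w) {z : ℂ} (hz : z ∈ segment ℝ (triMeshPoint δ u) (triMeshPoint δ w))
    (hzu : z ≠ triMeshPoint δ u) : AvoidsMeshOf G δ z := by
  constructor
  · intro g hg g' hg' hgg' hz'
    obtain ⟨l, rfl⟩ := (triGraph_adj_iff_triDir g g').1 hgg'
    obtain ⟨k, rfl⟩ := (triGraph_adj_iff_triDir u w).1 huw
    rcases meshEdge_inter hδ hz hz' with ⟨h1, h2⟩ | ⟨-, h⟩ | ⟨-, h⟩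
    · rcases h1 with h1 | rfl
      · exact hzu h1
      · rcases h2 with h2 | h2
        · exact hw (eq_of_triMeshPoint_eq hδ h2 ▸ hg)
        · exact hw (eq_of_triMeshPoint_eq hδ h2 ▸ hg')
    · exact hw (h ▸ hg')
    · exact hw (h ▸ hg)
  · intro F j hF hF' hz'
    rcases eq_side_of_mem_segment_mesh hδ (Or.inr huw) hz hz' with ⟨-, h2⟩ | ⟨-, h2⟩
    · exact hw (hF (h2 ▸ faceVertex_mem F _))
    · exact hw (hF (h2 ▸ faceVertex_mem F _))

/-- `√3 / 2 > 7 / 10`. [folklore] -/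
theorem seven_div_ten_lt_sqrt_three_div_two : (7 : ℝ) / 10 < Real.sqrt 3 / 2 := by
  rw [lt_div_iff₀ (by norm_num : (0 : ℝ) < 2), show (7 : ℝ) / 10 * 2 = 7 / 5 by norm_num,
    Real.lt_sqrt (by norm_num)]
  norm_num

/-- **Points within `0.7 δ` of the mesh point of a site off `G` avoid the discrete structure of
`G`.** [folklore] -/
theorem avoidsMeshOf_of_dist_le {G : Finset (Site 2)} {δ : ℝ} (hδ : 0 < δ) {a : Site 2} (ha : a ∉ G) {z : ℂ}
    (hz : dist z (triMeshPoint δ a) ≤ 7 / 10 * δ) : AvoidsMeshOf G δ z := by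
  have hlt : dist z (triMeshPoint δ a) < Real.sqrt 3 / 2 * δ :=
    hz.trans_lt (mul_lt_mul_of_pos_right seven_div_ten_lt_sqrt_three_div_two hδ)
  constructor
  · intro g hg g' hg' hgg' hz'
    obtain ⟨l, rfl⟩ := (triGraph_adj_iff_triDir g g').1 hgg'
    exact absurd (le_dist_of_mem_meshEdge hδ hz' (fun h : a = g => ha (h ▸ hg)) (fun h : a = g + triDir l => ha (h ▸ hg')))
      (not_le.2 hlt)
  · intro F j hF hF' hz'
    exact absurd (le_dist_of_mem_centreSeg hδ hz' (fun h => ha (hF h)) (fun h => ha (hF' h))) (not_le.2 hlt)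

/-! ### Tethers -/

/-- A **tether** of the dart `(u, w)` of `G` at mesh `δ` in the open set `U`: a path from the mesh
point of `u` to a point `tip` of `∂U`, inside `U` before its end, staying within `12δ` of the mesh point
of `u`, running along the mesh edge `[u, w]` up to the parameter `anchor`, where it is at the midpoint
of `[u, w]`, and from then on avoiding the closed mesh edges between sites of `G` and the centre
segments of adjacent faces of `G`
(cf. [cite: BollobasRiordan2006, Ch. 7 p. 191]). [folklore] -/
structure Tether (U : Set ℂ) (G : Finset (Site 2)) (δ : ℝ) (u w : Site 2) where
  /-- The endpoint on `∂U`. -/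
  tip : ℂ
  /-- The tether. -/
  path : Path (triMeshPoint δ u) tip
  /-- The parameter of the midpoint of `[u, w]`. -/
  anchor : unitInterval
  tip_mem : tip ∈ frontier U
  mem_of_lt_one : ∀ t : unitInterval, (t : ℝ) < 1 → path t ∈ U
  dist_le : ∀ t, dist (path t) (triMeshPoint δ u) ≤ 12 * δ
  anchor_eq : path anchor = midpoint ℝ (triMeshPoint δ u) (triMeshPoint δ w)
  before_anchor : ∀ t, t ≤ anchor → path t ∈ segment ℝ (triMeshPoint δ u) (triMeshPoint δ w)
  avoids : ∀ t, anchor ≤ t → AvoidsMeshOf G δ (path t)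

/-- A point of a segment whose endpoints are within `r` of `c` is within `r` of `c`. [folklore] -/
theorem dist_le_of_mem_segment {c p q z : ℂ} {r : ℝ} (hp : dist p c ≤ r) (hq : dist q c ≤ r)
    (hz : z ∈ segment ℝ p q) : dist z c ≤ r :=
  mem_closedBall.1 ((convex_closedBall c r).segment_subset (mem_closedBall.2 hp) (mem_closedBall.2 hq) hz)

/-- **Every boundary dart of the inner approximation of a Jordan domain has a tether** (the formal
counterpart of "every boundary site of `G_δ⁻` is within `ε₄ + 2δ` of `Γ`",
[cite: BollobasRiordan2006, Ch. 7 p. 191]). [folklore] -/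
theorem exists_tether (D : JordanDomain) {δ : ℝ} (hδ : 0 < δ) {c₀ : Site 2} (hc₀ : c₀ ∈ innerCoarse D.carrier δ)
    {u w : Site 2} (hd : (u, w) ∈ triBdryDarts (innerApprox D hδ hc₀).verts) :
    Nonempty (Tether D.carrier (innerApprox D hδ hc₀).verts δ u w) := by
  set G := (innerApprox D hδ hc₀).verts with hG
  set S₀ := innerCompFinset D hδ c₀ with hS₀
  obtain ⟨huG, hwG, hadj⟩ := mem_triBdryDarts.1 hd
  simp only at huG hwG hadj
  -- the bad point near the tile of `w` and its rounding `a`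
  obtain ⟨-, -, hcw⟩ := tileCentre_of_bdryDart (coe_innerCompFinset D hδ c₀) hd
  obtain ⟨y, hyU, hy⟩ := exists_not_mem_of_not_mem_innerCoarse hcw
  obtain ⟨a, ha⟩ := exists_dist_triMeshPoint_le hδ y
  have haG : a ∉ G := not_mem_innerApprox_of_near_not_mem D hδ hc₀ hyU (ha.trans (by linarith))
  -- the two tiles
  set cw := tileCentre w with hcw_def
  set ca := tileCentre a with hca_def
  have hmemG : ∀ x, x ∈ G ↔ tileCentre x ∈ S₀ := fun x => mem_tileUnion_iff
  have hcwS : cw ∉ S₀ := fun h => hwG ((hmemG w).2 h)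
  have hcaS : ca ∉ S₀ := fun h => haG ((hmemG a).2 h)
  have haa : dist (triMeshPoint δ a) (tileCentrePt δ ca) ≤ 2 * δ := dist_triMeshPoint_coarsePt_le hδ.le a
  have huw : dist (triMeshPoint δ u) (triMeshPoint δ w) = δ := dist_triMeshPoint_eq_of_adj hδ.le hadj
  have hcc : dist (tileCentrePt δ cw) (tileCentrePt δ ca) ≤ 67 / 10 * δ :=
    calc _ ≤ dist (tileCentrePt δ cw) y + dist y (tileCentrePt δ ca) := dist_triangle _ _ _
      _ ≤ dist (tileCentrePt δ cw) y + (dist y (triMeshPoint δ a) + dist (triMeshPoint δ a) (tileCentrePt δ ca)) := by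
        gcongr; exact dist_triangle _ _ _
      _ ≤ 4 * δ + (7 / 10 * δ + 2 * δ) := by rw [dist_comm] at hy; gcongr
      _ = _ := by ring
  have hcc' : cw = ca ∨ triGraph.Adj cw ca := by
    refine eq_or_adj_of_dist_tileCentrePt_lt hδ (hcc.trans_lt ?_)
    have := lt_sqrt_three_mul_sqrt_nineteen
    nlinarith
  -- the lattice path from `w` to `a` inside the two tiles
  set S' : Finset (Site 2) := {cw, ca} with hS'
  have hconn : ∀ c ∈ S', ∀ c' ∈ S', PathIn triGraph (↑S' : Set (Site 2)) c c' := by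
    have key : ∀ c c' : Site 2, c ∈ S' → c' ∈ S' → (c = c' ∨ triGraph.Adj c c') →
        PathIn triGraph (↑S' : Set (Site 2)) c c' := fun c c' hc hc' h => by
      rcases h with rfl | h
      · exact ⟨hc, Relation.ReflTransGen.refl⟩
      · exact ⟨hc, Relation.ReflTransGen.single ⟨h, hc'⟩⟩
    intro c hc c' hc'
    refine key c c' hc hc' ?_
    have hc2 := hc; have hc'2 := hc'
    simp only [hS', Finset.mem_insert, Finset.mem_singleton] at hc2 hc'2
    rcases hc2 with rfl | rfl <;> rcases hc'2 with rfl | rfl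
    · exact Or.inl rfl
    · exact hcc'
    · exact hcc'.imp Eq.symm fun h => h.symm
    · exact Or.inl rfl
  have hwS' : w ∈ tileUnion S' := mem_tileUnion_iff.2 (by simp [hS', hcw_def])
  have haS' : a ∈ tileUnion S' := mem_tileUnion_iff.2 (by simp [hS', hca_def])
  have hPI := pathIn_tileUnion hconn hwS' haS'
  obtain ⟨-, P, hP⟩ := exists_path_of_reflTransGen δ hPI.1 hPI.2
  have hAG : ∀ x ∈ (↑(tileUnion S') : Set (Site 2)), x ∉ G := fun x hx hxG => by
    have h1 : tileCentre x ∈ S' := mem_tileUnion_iff.1 hx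
    have h2 : tileCentre x ∈ S₀ := (hmemG x).1 hxG
    simp only [hS', Finset.mem_insert, Finset.mem_singleton] at h1
    rcases h1 with h1 | h1
    · exact hcwS (h1 ▸ h2)
    · exact hcaS (h1 ▸ h2)
  -- distances to the mesh point of `u`
  have hcwu : dist (tileCentrePt δ cw) (triMeshPoint δ u) ≤ 3 * δ :=
    calc _ ≤ dist (tileCentrePt δ cw) (triMeshPoint δ w) + dist (triMeshPoint δ w) (triMeshPoint δ u) := dist_triangle _ _ _
      _ ≤ 2 * δ + δ := by
          rw [dist_comm (triMeshPoint δ w) (triMeshPoint δ u), huw, dist_comm]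
          exact add_le_add_left (dist_triMeshPoint_coarsePt_le hδ.le w) _
      _ = 3 * δ := by ring
  have hAdist : ∀ x ∈ (↑(tileUnion S') : Set (Site 2)), dist (triMeshPoint δ x) (triMeshPoint δ u) ≤ 12 * δ := by
    intro x hx
    have h1 : tileCentre x ∈ S' := mem_tileUnion_iff.1 hx
    have hxc : dist (triMeshPoint δ x) (tileCentrePt δ (tileCentre x)) ≤ 2 * δ := dist_triMeshPoint_coarsePt_le hδ.le x
    have hcen : dist (tileCentrePt δ (tileCentre x)) (tileCentrePt δ cw) ≤ 67 / 10 * δ := by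
      simp only [hS', Finset.mem_insert, Finset.mem_singleton] at h1
      rcases h1 with h1 | h1
      · rw [h1, dist_self]; positivity
      · rw [h1, dist_comm]; exact hcc
    calc _ ≤ dist (triMeshPoint δ x) (tileCentrePt δ (tileCentre x)) + dist (tileCentrePt δ (tileCentre x)) (triMeshPoint δ u) :=
          dist_triangle _ _ _
      _ ≤ dist (triMeshPoint δ x) (tileCentrePt δ (tileCentre x)) +
          (dist (tileCentrePt δ (tileCentre x)) (tileCentrePt δ cw) + dist (tileCentrePt δ cw) (triMeshPoint δ u)) := by
          gcongr; exact dist_triangle _ _ _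
      _ ≤ 2 * δ + (67 / 10 * δ + 3 * δ) := by gcongr
      _ ≤ 12 * δ := by linarith
  have hydist : dist y (triMeshPoint δ u) ≤ 12 * δ :=
    calc _ ≤ dist y (tileCentrePt δ cw) + dist (tileCentrePt δ cw) (triMeshPoint δ u) := dist_triangle _ _ _
      _ ≤ 4 * δ + 3 * δ := by gcongr
      _ ≤ 12 * δ := by linarith
  have hPdist : ∀ z ∈ meshEdgeSet δ (↑(tileUnion S') : Set (Site 2)), dist z (triMeshPoint δ u) ≤ 12 * δ := by
    rintro z ⟨x, x', hx, hx', -, hz⟩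
    exact dist_le_of_mem_segment (hAdist x hx) (hAdist x' hx') hz
  -- the full path and its first exit from `U`
  set γ : Path (triMeshPoint δ u) y := (Path.segment (triMeshPoint δ u) (triMeshPoint δ w)).trans (P.trans (Path.segment (triMeshPoint δ a) y)) with hγ
  have huU : closedBall (triMeshPoint δ u) (2 * δ) ⊆ D.carrier := closedBall_subset_of_mem_innerApprox D hδ hc₀ huG
  obtain ⟨s, hs0, hsU, hsfr, hlt⟩ := exists_stop D.isOpen γ (huU (mem_closedBall_self (by positivity))) hyU
  have hfirst : ∀ r : unitInterval, (r : ℝ) ≤ 1 / 2 → γ r = AffineMap.lineMap (triMeshPoint δ u) (triMeshPoint δ w) (2 * (r : ℝ)) := fun r hr => by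
    rw [hγ, Path.trans_apply, dif_pos hr, Path.segment_apply]
  have hsecond : ∀ r : unitInterval, (1 : ℝ) / 2 < r →
      γ r ∈ meshEdgeSet δ (↑(tileUnion S') : Set (Site 2)) ∪ segment ℝ (triMeshPoint δ a) y := fun r hr => by
    rw [hγ, Path.trans_apply, dif_neg (not_le.2 hr)]
    have := mem_range_self (f := P.trans (Path.segment (triMeshPoint δ a) y))
      ⟨2 * (r : ℝ) - 1, unitInterval.two_mul_sub_one_mem_iff.2 ⟨(not_le.2 hr |> not_le.1).le, r.2.2⟩⟩
    rw [Path.trans_range, Path.range_segment] at this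
    rcases this with h | h
    · exact Or.inl (hP h)
    · exact Or.inr h
  have hlineMap_mem : ∀ θ : ℝ, 0 ≤ θ → θ ≤ 1 → AffineMap.lineMap (triMeshPoint δ u) (triMeshPoint δ w) θ ∈ segment ℝ (triMeshPoint δ u) (triMeshPoint δ w) := fun θ h0 h1 => by
    rw [segment_eq_image_lineMap]; exact ⟨θ, ⟨h0, h1⟩, rfl⟩
  have hseg_sub : segment ℝ (triMeshPoint δ u) (triMeshPoint δ w) ⊆ closedBall (triMeshPoint δ u) (2 * δ) :=
    (convex_closedBall _ _).segment_subset (mem_closedBall_self (by positivity))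
      (by rw [mem_closedBall, dist_comm, huw]; linarith)
  have hs2 : (1 : ℝ) / 2 < s := by
    by_contra h
    rw [not_lt] at h
    refine hsU ?_
    rw [hfirst s h]
    exact huU (hseg_sub (hlineMap_mem _ (by positivity) (by linarith)))
  -- the anchor parameter
  have hanc0 : (0 : ℝ) ≤ 1 / (4 * s) := by positivity
  have hanc1 : 1 / (4 * s) ≤ (1 : ℝ) := by rw [div_le_one (by positivity)]; linarith
  set anchor : unitInterval := ⟨1 / (4 * s), hanc0, hanc1⟩ with hanchor
  have hanc_mul : (anchor : ℝ) * s = 1 / 4 := by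
    show 1 / (4 * (s : ℝ)) * s = 1 / 4
    field_simp
  have hsub : ∀ t : unitInterval, ((γ.subpath 0 s).cast γ.source.symm rfl) t =
      γ ⟨(t : ℝ) * s, unitInterval.mul_mem t.2 s.2⟩ := fun t => by
    show γ (Set.Icc.convexComb 0 s t) = _
    congr 1
    exact Subtype.ext (by simp [Set.Icc.coe_convexComb])
  refine ⟨⟨γ s, (γ.subpath 0 s).cast γ.source.symm rfl, anchor, hsfr, ?_, ?_, ?_, ?_, ?_⟩⟩
  · intro t ht
    rw [hsub]
    refine hlt _ ?_
    show (t : ℝ) * s < s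
    calc (t : ℝ) * s < 1 * s := mul_lt_mul_of_pos_right ht hs0
      _ = s := one_mul _
  · intro t
    rw [hsub]
    have hmem := mem_range_self (f := γ) ⟨(t : ℝ) * s, unitInterval.mul_mem t.2 s.2⟩
    rw [hγ, Path.trans_range, Path.trans_range, Path.range_segment, Path.range_segment] at hmem
    rcases hmem with h | h | h
    · exact dist_le_of_mem_segment (by rw [dist_self]; positivity) (by rw [dist_comm, huw]; linarith) h
    · exact hPdist _ (hP h)
    · exact dist_le_of_mem_segment (hAdist a haS') hydist h
  · rw [hsub]
    have h14 : ((⟨(anchor : ℝ) * s, unitInterval.mul_mem anchor.2 s.2⟩ : unitInterval) : ℝ) ≤ 1 / 2 := by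
      show (anchor : ℝ) * s ≤ 1 / 2
      rw [hanc_mul]; norm_num
    rw [hfirst _ h14]
    show AffineMap.lineMap (triMeshPoint δ u) (triMeshPoint δ w) (2 * ((anchor : ℝ) * s)) = midpoint ℝ (triMeshPoint δ u) (triMeshPoint δ w)
    rw [hanc_mul, midpoint, invOf_eq_inv]
    norm_num
  · intro t ht
    rw [hsub]
    have hle : (t : ℝ) * s ≤ 1 / 4 := by
      rw [← hanc_mul]; exact mul_le_mul_of_nonneg_right ht hs0.le
    have h14 : ((⟨(t : ℝ) * s, unitInterval.mul_mem t.2 s.2⟩ : unitInterval) : ℝ) ≤ 1 / 2 := by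
      show (t : ℝ) * s ≤ 1 / 2; linarith
    rw [hfirst _ h14]
    have h0 : (0 : ℝ) ≤ (t : ℝ) * s := mul_nonneg t.2.1 hs0.le
    exact hlineMap_mem _ (by positivity) (by show 2 * ((t : ℝ) * s) ≤ 1; linarith)
  · intro t ht
    rw [hsub]
    set r : unitInterval := ⟨(t : ℝ) * s, unitInterval.mul_mem t.2 s.2⟩ with hr
    have hr4 : (1 : ℝ) / 4 ≤ r := by
      show 1 / 4 ≤ (t : ℝ) * s
      rw [← hanc_mul]
      exact mul_le_mul_of_nonneg_right ht hs0.le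
    by_cases hr2 : (r : ℝ) ≤ 1 / 2
    · rw [hfirst r hr2]
      refine avoidsMeshOf_of_mem_segment hδ.ne' hwG hadj (hlineMap_mem _ (by linarith) (by linarith)) fun h => ?_
      have hne : (triMeshPoint δ w) ≠ (triMeshPoint δ u) := fun e => by
        have : dist (triMeshPoint δ u) (triMeshPoint δ w) = 0 := by rw [e, dist_self]
        rw [huw] at this; exact hδ.ne' this
      rw [AffineMap.lineMap_apply_module] at h
      have h' : (2 * (r : ℝ)) • ((triMeshPoint δ w) - (triMeshPoint δ u)) = 0 := by
        rw [smul_sub]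
        have := h
        linear_combination (norm := skip) this
        simp only [sub_smul, one_smul]; abel
      rcases smul_eq_zero.1 h' with h'' | h''
      · linarith
      · exact hne (sub_eq_zero.1 h'')
    · rcases hsecond r (not_le.1 hr2) with h | h
      · exact avoidsMeshOf_of_mem_meshEdgeSet hδ.ne' hAG h
      · exact avoidsMeshOf_of_dist_le hδ haG (dist_le_of_mem_segment (by rw [dist_self]; positivity) ha h)

end Literature.Probability.Percolation
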